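import Summits.BirchSwinnertonDyer.BirchSwinnertonDyer.Theorems.PrintCf2SplitBadEisensteinTwoParityObstruction
import HarnessLib

/-!
# Crux `PrintCf2.SplitBadTwoRankOneOfFacts` (item 20368), line `eisenstein_two_bdp_line` (skeleton v7 40d712da) — THE `τ = 0` ROW KERNEL
# («atoms road»): HALVED ♭-frame `Q = 2·Q̃` + ♭-IMC equality `Ch_Λ(X)·𝓞⟦T⟧ = (Q̃)` + the odd-`p` control socket VERBATIM at `2` + Milne +
# `BSD₂` of the rank-zero twist ⟹ `BSD₂(W)`

Cell `bsd-print-cf2`, seat `bsd-line-cf2-p1-w2` g4 (prover, width seat on crux stmt-BirchSwinnertonDyer-20368; lead `bsd-line-cf2-p1` g6).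
`--supports stmt-BirchSwinnertonDyer-20368` (helper). Theses-free; THEOREMS ONLY (0 definitions, 0 named facts, 0 `sorry`); CONDITIONAL on every
displayed hypothesis (`hL` Liu–Zhang–Zhang, `hF` toric published inputs, `hMilne` Milne 1972, frames, ♭-IMC equality, control socket, twin
`BSD₂`). BSD is proved for no curve by any of this; nothing registered is negated; no summit statement is proved by this seat.

WHY. The registered skeleton v7 reads the (∅,0) descent at `2` with Castella-normalised frames `Q` (`R1.IsBDPLFunctionInt 2 …`), the ♭-IMC
equality `Ch·𝓞⟦T⟧ = (Q)` and control with net correction `τ = +1` (`stub_control_two`); the companion `PrintCf2SplitBadEisensteinTwoDescent`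
(p621296) is that row kernel. Two kernel facts now pull the other way: the lead g6's four-atom machine (announced 10:05Z) gives `τ = 0` from
finiteness atoms + Poitou–Tate, and `PrintCf2SplitBadEisensteinTwoParityObstruction` (p624788) shows frame + `Ch·𝓞⟦T⟧ = (Q)` + LZZ force `τ`
ODD by Cassels–Tate alone. If the atoms hold on the class, the stray factor `2` is on the ANALYTIC side: the Castella frame at `2` has
`Q(𝟙) = 2u·(log_ω P/c)²` (`‖u‖ = 1`; p619940/p620929), so the consistent reading is `Q = 2·Q̃`, `Ch·𝓞⟦T⟧ = (Q̃)` («`μ_Castella(Q) = 1`»;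
heuristically: at `2` the interpolation range consists of EVEN `n ≥ 2` only and `Γ(n)Γ(n+1) = (n−1)!·n!` is even for every `n ≥ 2`). THIS FILE is
the row kernel of that reading — reshape B of the line — so that the lead can re-cut to «`stub_control_two` := the odd-`p` socket
`SchneiderFree.AdditiveControlOnTreeAt 2` (a theorem modulo the four atoms + PT), stubs 1–3 re-typed for `Q̃` with frame `2·Q̃`» and have the
composition close in the kernel at once:
* §1 **`charExponent_eq_of_halvedIMCEq_two`** (core♭): frame `2·Q̃` + `Ch·𝓞⟦T⟧ = (Q̃)` + `HasCharValuationAt n` ⟹ `n = 2·ord₂ log_ω P − 2·ord₂ c`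
  (EVEN) — D2b on `2·Q̃`, the constant `2` divided out (`‖u/2‖₂ = 1`), `valuation_constantCoeff_eq_of_span_map_eq` with `a = 0`;
* §2 `kSideIdentity_of_correction_eq_zero_of_halvedCore` (arithmetic): `τ = 0` control + core♭ ⟹ the `K`-side identity of cell bsd-p2;
* §3 **`bsdp_two_of_halvedIMCEq_of_controlZero_of_twist`** — p621296's row kernel with `hEq ↦` halved ♭-IMC equality and `hCtl₂ (+1) ↦ hCtl₀` =
  the socket `SchneiderFree.AdditiveControlOnTreeAt 2 κ 𝔭 γ (embAt 𝔭) P` VERBATIM (the conclusion of the lead's `…_of_finAtoms` and of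
  bsd-schneider's `additiveControlOnTreeAt_of_torsAtoms`); the rest of the route (parity → FH field mod `6` → Heegner point → Kolyvagin → frame
  data → Milne/P2 descent → twin) is unchanged;
* §4 **`descent_two_of_controlZero`** — the class-wide form (hypotheses `W.HasCM`, `r_an = 1`, `CMSplit W 2`, `¬ Good W 2` give `4 ∣ N_W`), i.e.
  the old `stub_descent_two` body with frames/IMC halved and D2a replaced by the `τ = 0` socket.
FS1 (plan g8, kit j305479, 58/58 pairs): the `K`-side identity `ord₂ #Ш_an(W/K) + ord₂ ∏_w c_w = 2·ord₂[E(K):ℤP] − 2·ord₂ c` with `c` odd holds on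
every tested member — exactly §2's conclusion with `τ = 0` and core♭.

References: [JetchevSkinnerWan2017] §7.4.1, Thm. 3.3.1; [Castella2018] Thm. 2.3; [LiuZhangZhang2018] Thm 1.5.1/1.5.3; [GrossZagier1986] V.(2.2);
[Kolyvagin1990] Thm. A; [FriedbergHoffstein1995] Thm. B; [Milne1972ArithmeticAV] §1 Thm. 1.
-/

set_option autoImplicit false

-- D-0017 layout: summit = sub-problem, so `Summit.BirchSwinnertonDyer.BirchSwinnertonDyer.…` is the mandated namespace of Theorems files.
set_option linter.dupNamespace false

noncomputable section

open scoped Classical MatrixGroups ModularForm Topology NumberField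

namespace Summit.BirchSwinnertonDyer.BirchSwinnertonDyer.Theorems.PrintCf2.EisensteinTwo

open Filter CongruenceSubgroup WeierstrassCurve NumberField IsDedekindDomain Field PowerSeries
  Literature.NumberTheory.EllipticCurves Literature.NumberTheory.EllipticCurves.ModularForms
  Literature.NumberTheory.EllipticCurves.LiuZhangZhang2018 Literature.NumberTheory.EllipticCurves.Rank1Residual
  Literature.NumberTheory.EllipticCurves.Rank1Residual.Typed Literature.NumberTheory.EllipticCurves.KrizLi2019
  Literature.NumberTheory.GaloisRepresentations Literature.NumberTheory.GaloisCohomology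
  Summit.BirchSwinnertonDyer.Rank1Residual Summit.BirchSwinnertonDyer.Rank1Residual.X11b
  Summit.BirchSwinnertonDyer.Rank1Residual.X11b.AcSelmer Summit.BirchSwinnertonDyer.Rank1Residual.X11b.CongruenceLimit
  Summit.BirchSwinnertonDyer.Rank1Residual.X11b.Halves Summit.BirchSwinnertonDyer.Rank1Residual.X2
  Summit.BirchSwinnertonDyer.Rank1Residual.Additive
  Summit.BirchSwinnertonDyer.BirchSwinnertonDyer.Theses.UniversalToricDescent
  Summit.BirchSwinnertonDyer.BirchSwinnertonDyer.Theorems.UniversalToricDescentWaldspurgerFlat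

/-! ### §1 The control exponent at `p = 2` from the HALVED ♭-IMC equality (core♭) -/

section Core

/-- **Core♭ at `p = 2`: halved frame + halved ♭-IMC EQUALITY + control ⟹ `n = 2·ord₂ log_ω P − 2·ord₂ c`.** Data as in
`charExponent_eq_of_flatIMCEq_two` except that the Castella frame at `𝔭` is `2·Q̃` (`R1.IsBDPLFunctionInt 2 ι′ 𝔭 κ γ Dt.f Ω_K′ Ω_p′ (2·Q̃)`,
`Q̃ ∈ 𝓞_{ℂ₂}⟦T⟧`) and the ♭-IMC equality at `𝔭′` is against `Q̃`: `Ch_Λ(X_(∅,0))·𝓞_{ℂ₂}⟦T⟧ = (Q̃)`. Then the control exponent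
(`XAc.HasCharValuationAt … 𝔭′ … n`) is `n = 2·padicLogOrd W 2 (embAt 𝔭′) P − 2·ord₂ c` — EVEN, the parity of the atoms' formula with `τ = 0`.
Proof: D2b (`intSeries_value_of_frame_manin_two`: `(2·Q̃)(𝟙) = u·(log_ω P/c)²`, `‖u‖₂ = 1/2`), so `Q̃(𝟙) = (u/2)·(log_ω P/c)²` with `‖u/2‖₂ = 1`;
the square of the log moved to `𝔭′`; `valuation_constantCoeff_eq_of_span_map_eq` with `a = 0`. CONDITIONAL on `hL`.
[cite: LiuZhangZhang2018, Thm 1.5.1 and Thm 1.5.3 (Duke Math. J. 167 pp. 748–749)] [cite: Castella2018, Thm. 2.3 (arXiv:1704.06608 p. 5) (shape)] -/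
theorem charExponent_eq_of_halvedIMCEq_two
    (hL : thm151_thm153_modularCurve_heegnerVector_additive)
    (W : WeierstrassCurve ℚ) [W.IsElliptic] [W.IsGloballyMinimal]
    (K : Type) [Field K] [NumberField K]
    (κ : ZpExtension K 2) (γ : absoluteGaloisGroup K) [Fact (κ.IsTopGenerator γ)] {N : ℕ} [NeZero N]
    (Dt : ModularParametrizationData W N) (H : HeegnerDatum N (NumberField.discr K))
    (ιK : K →+* ℂ) (P : (W.baseChange K).toAffine.Point)
    (hN : W.conductorNorm ℤ = N) (h4N : 2 ^ 2 ∣ N) (hK : IsImaginaryQuadratic K)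
    (hd4 : NumberField.discr K < -4) (hHN : SatisfiesHeegnerHypothesis N K) (hκ : κ.IsAnticyclotomic)
    (hP : WeierstrassCurve.Affine.Point.map ιK.toRatAlgHom P = heegnerPointComplex Dt H)
    (hPinf : ¬ IsOfFinAddOrder P) (hrk : (W.baseChange K).mordellWeilRank = 1)
    (𝔭 : HeightOneSpectrum (𝓞 K)) (h𝔭 : ((2 : ℕ) : 𝓞 K) ∈ 𝔭.asIdeal) (he : 𝔭.asIdeal.ramificationIdx (𝓞 ℚ) = 1)
    (hf : 𝔭.asIdeal.inertiaDeg (𝓞 ℚ) = 1)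
    (𝔭' : HeightOneSpectrum (𝓞 K)) (h𝔭' : ((2 : ℕ) : 𝓞 K) ∈ 𝔭'.asIdeal) (he' : 𝔭'.asIdeal.ramificationIdx (𝓞 ℚ) = 1)
    (hf' : 𝔭'.asIdeal.inertiaDeg (𝓞 ℚ) = 1)
    (ι' : PadicAlgCl 2 ≃+* ℂ) (hind : SchneiderFree.BranchInducesPrime 2 ι' 𝔭)
    {ΩK' : ℂ} {Ωp' : ℂ_[2]} {Qh : PowerSeries (PadicComplexInt 2)} (hΩK' : ΩK' ≠ 0) (hΩp' : Ωp' ≠ 0)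
    (hQ : R1.IsBDPLFunctionInt 2 ι' 𝔭 κ γ Dt.f ΩK' Ωp' (2 * Qh))
    {n : ℕ} (hn : XAc.HasCharValuationAt (W.baseChange K) 2 κ 𝔭' ∅ γ n)
    (hEq : (XAc.charIdeal (W.baseChange K) 2 κ 𝔭' ∅ γ).map (PowerSeries.map (R1.toCpInt 2)) = Ideal.span {Qh}) :
    (n : ℤ) = 2 * X11b.padicLogOrd W 2 (embAt K 2 𝔭' h𝔭' he' hf') P - 2 * (padicValNat 2 Dt.c.natAbs : ℤ) := by
  -- D2b at `𝔭` for the frame `2·Q̃`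
  obtain ⟨u, hu, hval⟩ := intSeries_value_of_frame_manin_two hL W K 𝔭 κ γ Dt H ιK P hN h4N hK hd4 h𝔭 he hf hHN hκ hP hPinf ι'
    hind hΩK' hΩp' hQ
  -- move the square of the log to `𝔭′`
  have hc0 : Dt.c ≠ 0 := Dt.maninConstant_ne_zero_holds
  have hc0' : (Dt.c : ℚ_[2]) ≠ 0 := by exact_mod_cast hc0
  have hlog : logOmega W 2 (embAt K 2 𝔭' h𝔭' he' hf') P ≠ 0 := X11b.R1.logOmega_ne_zero W 2 _ hPinf
  have hsq : (algebraMap ℚ_[2] ℂ_[2] (logOmega W 2 (embAt K 2 𝔭 h𝔭 he hf) P / (Dt.c : ℚ_[2]))) ^ 2 =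
      (algebraMap ℚ_[2] ℂ_[2] (logOmega W 2 (embAt K 2 𝔭' h𝔭' he' hf') P / (Dt.c : ℚ_[2]))) ^ 2 := by
    rw [← map_pow, ← map_pow, div_pow, div_pow,
      SchneiderFreeAdditiveX3.sq_logOmega_embAt_eq_of_rank_one W 2 hK.1 hrk h𝔭 he hf h𝔭' he' hf' P]
  set x : ℚ_[2] := logOmega W 2 (embAt K 2 𝔭' h𝔭' he' hf') P / (Dt.c : ℚ_[2]) with hx_def
  have hval' : IntSeries.HasValueAt (2 * Qh) 0 (u * (algebraMap ℚ_[2] ℂ_[2] x) ^ 2) := by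
    rw [hx_def, ← hsq]; exact hval
  -- divide the constant `2` out: `Q̃(0) = (u/2)·x²`
  have h2C0 : (2 : ℂ_[2]) ≠ 0 := two_ne_zero
  have hcc : u * (algebraMap ℚ_[2] ℂ_[2] x) ^ 2 = 2 * ((constantCoeff Qh : PadicComplexInt 2) : ℂ_[2]) := by
    rw [R1.intSeries_eq_constantCoeff_of_hasValueAt_zero 2 hval', map_mul, MulMemClass.coe_mul, map_ofNat]; rfl
  have hvalh : IntSeries.HasValueAt Qh 0 (((2 : ℂ_[2])⁻¹ * u) * (algebraMap ℚ_[2] ℂ_[2] x) ^ 2) := by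
    have h := R1.intSeries_hasValueAt_zero 2 Qh
    have hc : ((constantCoeff Qh : PadicComplexInt 2) : ℂ_[2]) = ((2 : ℂ_[2])⁻¹ * u) * (algebraMap ℚ_[2] ℂ_[2] x) ^ 2 := by
      rw [mul_assoc, hcc, ← mul_assoc, inv_mul_cancel₀ h2C0, one_mul]
    rwa [hc] at h
  -- `‖u/2‖ = 1 = (2⁻¹)^0`
  have h2norm : ‖(2 : ℂ_[2])‖ = 2⁻¹ := by
    simpa using Literature.NumberTheory.LFunctions.Dwork.norm_natCast_p_padicComplex (p := 2)
  have hu' : ‖(2 : ℂ_[2])⁻¹ * u‖ = ((2 : ℕ) : ℝ)⁻¹ ^ 0 := by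
    rw [pow_zero, norm_mul, norm_inv, h2norm, hu]; norm_num
  -- the algebraic side: `Ch = (f)`, `ord₂ f(0) = n`, and the equality `(f)·𝓞⟦T⟧ = (Q̃)`
  obtain ⟨-, f, hfI, hf0, hfn⟩ := hn
  have hspan : Ideal.span {PowerSeries.map (R1.toCpInt 2) f} = Ideal.span {Qh} := by
    rw [← map_span_singleton_powerSeries, ← hfI]; exact hEq
  obtain ⟨-, hv⟩ := valuation_constantCoeff_eq_of_span_map_eq (p := 2) hf0 hspan hu' hvalh
  rw [hfn, hx_def, div_eq_mul_inv, Padic.valuation_mul hlog (inv_ne_zero hc0'), Padic.valuation_inv, Padic.valuation_intCast,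
    valuation_logOmega hlog] at hv
  simp only [padicValInt, Nat.cast_zero] at hv
  linarith

end Core

/-! ### §2 Arithmetic: `τ = 0` control + core♭ ⟹ the `K`-side identity -/

/-- **The `K`-side `2`-part of BSD from `τ = 0` control and core♭ (arithmetic).** With `n = s + 2·(ℓ − i) + t` (the odd-`p` socket's formula,
`τ = 0`) and `n = 2ℓ − 2v` (core♭), cell bsd-p2's `K`-side identity `2 + 2i = 2v + 2·1 + t + s` holds. Compare
`kSideIdentity_iff_correction_eq_one` (core `1 + 2ℓ − 2v` needs `τ = 1`): halving the frame moves the unit from the control side to the analytic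
side. [cite: GrossZagier1986, V.(2.2)] [cite: JetchevSkinnerWan2017, Thm. 3.3.1 (shape)] -/
theorem kSideIdentity_of_correction_eq_zero_of_halvedCore {n s ℓ i t v : ℤ} (hctl : n = s + 2 * (ℓ - i) + t)
    (hcore : n = 2 * ℓ - 2 * v) : 2 + 2 * i = 2 * v + 2 * 1 + t + s := by
  linarith

/-! ### §3 The `τ = 0` row kernel -/

/-- **THE `τ = 0` ROW KERNEL («atoms road») for line `eisenstein_two_bdp_line`: halved ♭-frames + halved ♭-IMC equality + the odd-`p` control
socket VERBATIM at `2` + twin ⟹ `BSD₂(W)`.** For ONE globally minimal `W/ℚ` with `4 ∣ N_W` and `r_an(W) = 1`, GIVEN `hF`, `hL`, `hMilne` as in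
`bsdp_two_of_flatIMCEq_of_controlTwo_of_twist`; `hFr♭`: at every Heegner field / anticyclotomic frame / degree-one `𝔭 ∣ 2` / `ι′` inducing `𝔭` a
HALVED integral frame `(Ω_K, Ω_p, Q̃)`, `R1.IsBDPLFunctionInt 2 ι′ 𝔭 κ γ Dt.f Ω_K Ω_p (2·Q̃)`; `hTor` (= `stub_torsion_two` for this `W`); `hEq♭`: the
♭-IMC EQUALITY against `Q̃` under torsion; `hTw`: `BSD₂` of the globally minimal models of the rank-zero Heegner twists; and **`hCtl₀` = the
odd-`p` socket at `2`**: at every Heegner datum (`L(E^{(d_K)},1) ≠ 0`, `P` non-torsion, Kolyvagin as antecedent), every `(κ, γ)`, every degree-one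
`𝔭 ∣ 2`: `SchneiderFree.AdditiveControlOnTreeAt 2 κ 𝔭 γ (embAt 𝔭) P` (`τ = 0`; the conclusion of bsd-schneider's `additiveControlOnTreeAt_of_torsAtoms`
and of the lead g6's four-atom machine) — THEN `BSD₂(W)`. Route identical to p621296's; only the core (§1) and the arithmetic (§2) change.
[cite: JetchevSkinnerWan2017, §7.4.1 and Thm. 3.3.1 (arXiv:1512.06894 pp. 11, 30) (shape)] [cite: LiuZhangZhang2018, Thm 1.5.1 and Thm 1.5.3]
[cite: Milne1972ArithmeticAV, §1 Thm. 1] [cite: GrossZagier1986, V.(2.2)] [cite: FriedbergHoffstein1995, Thm. B] -/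
theorem bsdp_two_of_halvedIMCEq_of_controlZero_of_twist
    (hF : ToricPublishedInputs) (hL : thm151_thm153_modularCurve_heegnerVector_additive)
    (hMilne : Milne1972.bsdQuotient_baseChange_quadratic)
    (W : WeierstrassCurve ℚ) [W.IsElliptic] [W.IsGloballyMinimal] (h4N : 2 ^ 2 ∣ W.conductorNorm ℤ) (hr : W.analyticRank = 1)
    (hFr : ∀ (N : ℕ) [NeZero N] (K : Type) [Field K] [NumberField K] (Dt : ModularParametrizationData W N),
      W.conductorNorm ℤ = N → IsImaginaryQuadratic K → SatisfiesHeegnerHypothesis N K →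
      ∀ (κ : ZpExtension K 2), κ.IsAnticyclotomic → ∀ (γ : Field.absoluteGaloisGroup K) [Fact (κ.IsTopGenerator γ)]
        (𝔭 : HeightOneSpectrum (𝓞 K)), ((2 : ℕ) : 𝓞 K) ∈ 𝔭.asIdeal → 𝔭.asIdeal.ramificationIdx (𝓞 ℚ) = 1 →
        𝔭.asIdeal.inertiaDeg (𝓞 ℚ) = 1 → ∀ (ι' : PadicAlgCl 2 ≃+* ℂ), SchneiderFree.BranchInducesPrime 2 ι' 𝔭 →
        ∃ (ΩK : ℂ) (Ωp : ℂ_[2]) (Qh : PowerSeries (PadicComplexInt 2)),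
          ΩK ≠ 0 ∧ Ωp ≠ 0 ∧ R1.IsBDPLFunctionInt 2 ι' 𝔭 κ γ Dt.f ΩK Ωp (2 * Qh))
    (hTor : ∀ (N : ℕ) [NeZero N] (K : Type) [Field K] [NumberField K],
      W.conductorNorm ℤ = N → IsImaginaryQuadratic K → SatisfiesHeegnerHypothesis N K →
      ∀ (κ : ZpExtension K 2), κ.IsAnticyclotomic → ∀ (γ : Field.absoluteGaloisGroup K) [Fact (κ.IsTopGenerator γ)]
        (𝔭 : HeightOneSpectrum (𝓞 K)), ((2 : ℕ) : 𝓞 K) ∈ 𝔭.asIdeal → 𝔭.asIdeal.ramificationIdx (𝓞 ℚ) = 1 →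
        𝔭.asIdeal.inertiaDeg (𝓞 ℚ) = 1 → ∀ (𝔭' : HeightOneSpectrum (𝓞 K)), ((2 : ℕ) : 𝓞 K) ∈ 𝔭'.asIdeal → 𝔭' ≠ 𝔭 →
        Module.IsTorsion (IwasawaAlgebra 2) (XAc (W.baseChange K) 2 κ 𝔭' ∅ γ))
    (hEq : ∀ (N : ℕ) [NeZero N] (K : Type) [Field K] [NumberField K] (Dt : ModularParametrizationData W N),
      W.conductorNorm ℤ = N → IsImaginaryQuadratic K → SatisfiesHeegnerHypothesis N K →
      ∀ (κ : ZpExtension K 2), κ.IsAnticyclotomic → ∀ (γ : Field.absoluteGaloisGroup K) [Fact (κ.IsTopGenerator γ)]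
        (𝔭 : HeightOneSpectrum (𝓞 K)), ((2 : ℕ) : 𝓞 K) ∈ 𝔭.asIdeal → 𝔭.asIdeal.ramificationIdx (𝓞 ℚ) = 1 →
        𝔭.asIdeal.inertiaDeg (𝓞 ℚ) = 1 → ∀ (𝔭' : HeightOneSpectrum (𝓞 K)), ((2 : ℕ) : 𝓞 K) ∈ 𝔭'.asIdeal → 𝔭' ≠ 𝔭 →
        ∀ (ι' : PadicAlgCl 2 ≃+* ℂ), SchneiderFree.BranchInducesPrime 2 ι' 𝔭 →
        ∀ (ΩK : ℂ) (Ωp : ℂ_[2]) (Qh : PowerSeries (PadicComplexInt 2)), ΩK ≠ 0 → Ωp ≠ 0 →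
          R1.IsBDPLFunctionInt 2 ι' 𝔭 κ γ Dt.f ΩK Ωp (2 * Qh) →
          Module.IsTorsion (IwasawaAlgebra 2) (XAc (W.baseChange K) 2 κ 𝔭' ∅ γ) →
          (XAc.charIdeal (W.baseChange K) 2 κ 𝔭' ∅ γ).map (PowerSeries.map (R1.toCpInt 2)) = Ideal.span {Qh})
    (hTw : ∀ (N : ℕ) [NeZero N] (K : Type) [Field K] [NumberField K]
      (Wd : WeierstrassCurve ℚ) [Wd.IsElliptic] [Wd.IsGloballyMinimal],
      W.conductorNorm ℤ = N → IsImaginaryQuadratic K → SatisfiesHeegnerHypothesis N K →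
      (∃ C : VariableChange ℚ, C • W.quadraticTwist (NumberField.discr K : ℚ) = Wd) →
      (W.quadraticTwist (NumberField.discr K : ℚ)).entireLFunction 1 ≠ 0 → BSDp Wd 2)
    (hCtl₀ : ∀ (N : ℕ) [NeZero N] (K : Type) [Field K] [NumberField K] (Dt : ModularParametrizationData W N)
      (H : HeegnerDatum N (NumberField.discr K)) (ι : K →+* ℂ) (P : (W.baseChange K).toAffine.Point),
      W.conductorNorm ℤ = N → IsImaginaryQuadratic K → SatisfiesHeegnerHypothesis N K →
      (W.quadraticTwist (NumberField.discr K : ℚ)).entireLFunction 1 ≠ 0 →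
      WeierstrassCurve.Affine.Point.map ι.toRatAlgHom P = heegnerPointComplex Dt H → ¬ IsOfFinAddOrder P →
      Literature.NumberTheory.EllipticCurves.kolyvagin N W K →
      ∀ (κ : ZpExtension K 2), κ.IsAnticyclotomic → ∀ (γ : Field.absoluteGaloisGroup K) [Fact (κ.IsTopGenerator γ)]
        (𝔭 : HeightOneSpectrum (𝓞 K)) (h𝔭 : ((2 : ℕ) : 𝓞 K) ∈ 𝔭.asIdeal) (he : 𝔭.asIdeal.ramificationIdx (𝓞 ℚ) = 1)
        (hf : 𝔭.asIdeal.inertiaDeg (𝓞 ℚ) = 1),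
        SchneiderFree.AdditiveControlOnTreeAt 2 κ 𝔭 γ (embAt K 2 𝔭 h𝔭 he hf) P) :
    BSDp W 2 := by
  obtain ⟨hGZ, hKo, hGZK, hmod, hmodP, -, hGZ73, hFH, hpar, hHP⟩ := hF
  haveI hN0 : NeZero (W.conductorNorm ℤ) := ⟨W.conductorNorm_pos_holds.ne'⟩
  ------------------------------------------------------------------ parity and the Friedberg–Hoffstein field (modulus `6`)
  have hw : W.rootNumber = -1 := by
    rcases W.rootNumber_eq_one_or with h | h
    · exfalso
      have heven : Even W.analyticRank := (hpar W).mpr h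
      rw [hr] at heven
      exact Nat.not_even_one heven
    · exact h
  obtain ⟨K, _, _, hK, -, hHN, hH6, hLt⟩ := hFH W hw 6 (by norm_num) 0
  have hd4 : NumberField.discr K < -4 :=
    discr_lt_neg_four_of_three_split hK (hH6 3 Nat.prime_three (by norm_num : (3 : ℕ) ∣ 6))
  have hw2 : Units.torsionOrder K = 2 :=
    Literature.NumberTheory.QuadraticFields.Quadratic.torsionOrder_eq_two_of_discr_lt_neg_four hK.1 hd4
  have h2N : (2 : ℕ) ∣ W.conductorNorm ℤ := dvd_trans (dvd_pow_self 2 two_ne_zero) h4N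
  have hsplit : SplitsIn K 2 := hHN 2 Nat.prime_two h2N
  ------------------------------------------------------------------ the Heegner point, non-torsion, Kolyvagin
  obtain ⟨P, Dt, H, ι, hP⟩ := hHP W K hK hHN
  have hL0 : W.entireLFunction 1 = 0 := entireLFunction_one_eq_zero_of_analyticRank_eq_one hr
  obtain ⟨-, hderiv⟩ := leadingLCoeff_eq_deriv_of_analyticRank_eq_one hr
  have hLK : LDerivEK W K ≠ 0 := by
    rw [lDerivEK_eq_deriv_mul W K hmod hL0]; exact mul_ne_zero hderiv hLt
  have hnt : ¬ IsOfFinAddOrder P :=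
    (lDerivEK_ne_zero_iff_not_isOfFinAddOrder W (W.conductorNorm ℤ) K (hGZ _ W K) hK hHN ⟨Dt, H, ι, hP⟩).mp hLK
  have hKoK : Literature.NumberTheory.EllipticCurves.kolyvagin (W.conductorNorm ℤ) W K := hKo _ W K
  obtain ⟨hrk, hfinK⟩ := hKoK hK hHN ⟨Dt, H, ι, hP⟩ hnt
  haveI : Finite (W.baseChange K).sha := hfinK
  have hc0 : Dt.c ≠ 0 := Dt.maninConstant_ne_zero_holds
  ------------------------------------------------------------------ the anticyclotomic frame data at `2`
  obtain ⟨κ, γ, -, hκ, hγ, -⟩ := X11b.exists_anticyclotomic_generator_prime (p := 2) hK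
  haveI : Fact (κ.IsTopGenerator γ) := ⟨hγ⟩
  obtain ⟨𝔭, h𝔭, he, hf⟩ := X11b.exists_degreeOnePrime_of_splitsIn K 2 hK.1 hsplit
  obtain ⟨𝔭', hne, h𝔭', he', hf'⟩ := X11b.Three.exists_ne_degreeOne_prime hK.1 h𝔭 he hf
  obtain ⟨ι₀⟩ := PadicAlgCl.nonempty_ringEquiv_complex 2
  obtain ⟨ι', -, hind⟩ := exists_datum_forall_mem_iff 2 ι₀ hK h𝔭
  ------------------------------------------------------------------ halved frame, torsion, halved IMC equality, `τ = 0` control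
  obtain ⟨ΩK, Ωp, Qh, hΩK, hΩp, hQ⟩ := hFr (W.conductorNorm ℤ) K Dt rfl hK hHN κ hκ γ 𝔭 h𝔭 he hf ι' hind
  have htors : Module.IsTorsion (IwasawaAlgebra 2) (XAc (W.baseChange K) 2 κ 𝔭' ∅ γ) :=
    hTor (W.conductorNorm ℤ) K rfl hK hHN κ hκ γ 𝔭 h𝔭 he hf 𝔭' h𝔭' hne
  have hEq₁ : (XAc.charIdeal (W.baseChange K) 2 κ 𝔭' ∅ γ).map (PowerSeries.map (R1.toCpInt 2)) = Ideal.span {Qh} :=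
    hEq (W.conductorNorm ℤ) K Dt rfl hK hHN κ hκ γ 𝔭 h𝔭 he hf 𝔭' h𝔭' hne ι' hind ΩK Ωp Qh hΩK hΩp hQ htors
  obtain ⟨n, hn, hnf⟩ := hCtl₀ (W.conductorNorm ℤ) K Dt H ι P rfl hK hHN hLt hP hnt hKoK κ hκ γ 𝔭' h𝔭' he' hf'
  -- the socket's split Tamagawa product is the full one over a Heegner field
  rw [X11b.padicValNat_tamagawaProductSplit_eq_of_heegner_prime W K 2 rfl hHN] at hnf
  ------------------------------------------------------------------ CORE♭: `n = 2·padicLogOrd − 2·ord₂ c`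
  have hcore := charExponent_eq_of_halvedIMCEq_two hL W K κ γ Dt H ι P rfl h4N hK hd4 hHN hκ hP hnt hrk 𝔭 h𝔭 he hf 𝔭' h𝔭' he'
    hf' ι' hind hΩK hΩp hQ hn hEq₁
  ------------------------------------------------------------------ the `K`-side identity `ord₂ (4 I²/(c² w² c_K)) = ord₂ #Ш(E_K)`
  set I : ℕ := (AddSubgroup.zmultiples P).index with hI_def
  have hheight := Summit.BirchSwinnertonDyer.Rank1Residual.P2.torsionOrder_sq_mul_canonicalHeight_eq_index_sq_mul_regulator
    (W.baseChange K) hrk P hnt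
  have htK : 0 < (W.baseChange K).torsionOrder := (W.baseChange K).torsionOrder_pos_holds
  have hI0 : I ≠ 0 := by
    intro hI
    rw [← hI_def, hI] at hheight
    have h0 : ((W.baseChange K).torsionOrder : ℝ) ^ 2 * P.canonicalHeight = 0 := by rw [hheight]; simp
    rcases mul_eq_zero.mp h0 with h' | h'
    · exact absurd ((pow_eq_zero_iff two_ne_zero).mp h') (by exact_mod_cast htK.ne')
    · exact hnt ((Affine.Point.canonicalHeight_eq_zero_iff_holds P).mp h')
  have hcK : 0 < (W.baseChange K).tamagawaProduct := (W.baseChange K).tamagawaProduct_pos_holds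
  have hIQ : (I : ℚ) ≠ 0 := by exact_mod_cast hI0
  have hcQ : (Dt.c : ℚ) ≠ 0 := by exact_mod_cast hc0
  have hwQ : (Units.torsionOrder K : ℚ) ≠ 0 := by rw [hw2]; norm_num
  have hcKQ : ((W.baseChange K).tamagawaProduct : ℚ) ≠ 0 := by exact_mod_cast hcK.ne'
  have hsha : padicValNat 2 (Nat.card (AddCommGroup.primaryComponent (W.baseChange K).sha 2)) =
      padicValNat 2 (W.baseChange K).shaOrder :=
    Literature.NumberTheory.EllipticCurves.padicValNat_card_addPrimaryComponent 2
  have hcval : padicValRat 2 (Dt.c : ℚ) = (padicValNat 2 Dt.c.natAbs : ℤ) := by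
    rw [padicValRat.of_int]; rfl
  have h2val : padicValRat 2 (((2 : ℕ) : ℚ)) = 1 := by
    rw [padicValRat.of_nat, padicValNat_self]; rfl
  have h4val : padicValRat 2 (4 : ℚ) = 2 := by
    rw [show (4 : ℚ) = ((2 : ℕ) : ℚ) ^ 2 by norm_num, padicValRat.pow, h2val]; norm_num
  have hLHS : padicValRat 2 (4 * (I : ℚ) ^ 2 / ((Dt.c : ℚ) ^ 2 * (Units.torsionOrder K : ℚ) ^ 2 *
      ((W.baseChange K).tamagawaProduct : ℚ))) =
      2 + 2 * (padicValNat 2 I : ℤ) - (2 * (padicValNat 2 Dt.c.natAbs : ℤ) + 2 * 1 +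
        (padicValNat 2 (W.baseChange K).tamagawaProduct : ℤ)) := by
    rw [padicValRat.div (mul_ne_zero (by norm_num) (pow_ne_zero 2 hIQ))
        (mul_ne_zero (mul_ne_zero (pow_ne_zero 2 hcQ) (pow_ne_zero 2 hwQ)) hcKQ),
      padicValRat.mul (by norm_num) (pow_ne_zero 2 hIQ), padicValRat.mul (mul_ne_zero (pow_ne_zero 2 hcQ) (pow_ne_zero 2 hwQ)) hcKQ,
      padicValRat.mul (pow_ne_zero 2 hcQ) (pow_ne_zero 2 hwQ), padicValRat.pow, padicValRat.pow, padicValRat.pow, h4val, hw2, hcval,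
      h2val, padicValRat.of_nat, padicValRat.of_nat]
    push_cast
    ring
  have hv : padicValRat 2 (4 * (I : ℚ) ^ 2 / ((Dt.c : ℚ) ^ 2 * (Units.torsionOrder K : ℚ) ^ 2 *
      ((W.baseChange K).tamagawaProduct : ℚ))) = padicValNat 2 (W.baseChange K).shaOrder := by
    rw [hLHS, ← hsha]
    linarith [hcore, hnf]
  ------------------------------------------------------------------ P2's over-`K` descent (Milne) and the twin
  have h2 : Module.finrank ℚ K = 2 := hK.1
  haveI : (W.baseChange K).IsGloballyMinimal := W.isGloballyMinimal_baseChange_of_satisfiesHeegnerHypothesis K h2 hHN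
  have hD0 : (NumberField.discr K : ℚ) ≠ 0 := by exact_mod_cast NumberField.discr_ne_zero K
  haveI hEt : (W.quadraticTwist (NumberField.discr K : ℚ)).IsElliptic := W.isElliptic_quadraticTwist hD0
  have hrK : (W.baseChange K).analyticRank = 1 :=
    (Summit.BirchSwinnertonDyer.Rank1Residual.P2.analyticRank_baseChange_eq_one_iff W K hmod h2).mpr
      (Or.inl ⟨hr, ((W.quadraticTwist (NumberField.discr K : ℚ)).analyticRank_eq_zero_iff_holds (hmod _)).mpr hLt⟩)
  obtain ⟨Cd, hCd⟩ := hasGlobalMinimalModel_rat_holds (W.quadraticTwist (NumberField.discr K : ℚ))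
  haveI : (Cd • W.quadraticTwist (NumberField.discr K : ℚ)).IsGloballyMinimal := hCd
  have hWd : BSDp (Cd • W.quadraticTwist (NumberField.discr K : ℚ)) 2 :=
    hTw (W.conductorNorm ℤ) K (Cd • W.quadraticTwist (NumberField.discr K : ℚ)) rfl hK hHN ⟨Cd, rfl⟩ hLt
  exact (Summit.BirchSwinnertonDyer.Rank1Residual.P2.bsdp_iff_bsdp_twist_of_heegnerIndexOverK W 2 K
    (Cd • W.quadraticTwist (NumberField.discr K : ℚ)) (W.conductorNorm ℤ) Dt H ι P (hGZ _ W K) hKoK hGZK hmod hMilne hK hHN hP hc0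
    hrK ⟨Cd, rfl⟩ hv).mpr hWd

/-! ### §4 The class-wide form: the old `stub_descent_two` body with halved frames and the `τ = 0` socket for D2a -/

/-- **`descent_two_of_controlZero` — the class-wide `τ = 0` descent (reshape B of the line).** `hMilne` = Milne 1972 §1 Thm 1 (tree named
fact); `hD2a₀` = the odd-`p` control socket at `2` on the class, at every Heegner datum / anticyclotomic frame / degree-one `𝔭 ∣ 2`:
`SchneiderFree.AdditiveControlOnTreeAt 2 κ 𝔭 γ (embAt 𝔭) P` (a theorem modulo the lead g6's four atoms + Poitou–Tate). Then, granted «PRINTS(2)»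
(the eight-conjunct bundle of the registered stubs, only `ToricPublishedInputs` and LZZ used), for `W` in the class (`W.HasCM`, `r_an(W) = 1`,
`CMSplit W 2`, `¬ Good W 2` — CM is never multiplicative, so `4 ∣ N_W`): HALVED frames (`∃ Ω_K Ω_p Q̃, … R1.IsBDPLFunctionInt 2 … (2·Q̃)`) ∧
torsion ∧ HALVED ♭-IMC equality ∧ twin `BSD₂` ⟹ `BSDp W 2`. This is the composition the lead needs if v7 is re-cut to reshape B
(`stub_control_two` := socket `τ = 0`; stubs 1–3 for `Q̃`). [cite: Milne1972ArithmeticAV, §1 Thm. 1] [cite: JetchevSkinnerWan2017, Thm. 3.3.1 (shape)]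
[cite: Ogg1966, main theorem (CM curves are not semistable at bad primes)] -/
theorem descent_two_of_controlZero (hMilne : Milne1972.bsdQuotient_baseChange_quadratic)
    (hD2a₀ : ∀ (W : WeierstrassCurve ℚ) [W.IsElliptic] [W.IsGloballyMinimal],
      W.HasCM → W.analyticRank = 1 → CMSplit W 2 → ¬ Good W 2 →
      ∀ (N : ℕ) [NeZero N] (K : Type) [Field K] [NumberField K] (Dt : ModularParametrizationData W N)
        (H : HeegnerDatum N (NumberField.discr K)) (ι : K →+* ℂ) (P : (W.baseChange K).toAffine.Point),
        W.conductorNorm ℤ = N → IsImaginaryQuadratic K → SatisfiesHeegnerHypothesis N K →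
        (W.quadraticTwist (NumberField.discr K : ℚ)).entireLFunction 1 ≠ 0 →
        WeierstrassCurve.Affine.Point.map ι.toRatAlgHom P = heegnerPointComplex Dt H → ¬ IsOfFinAddOrder P →
        Literature.NumberTheory.EllipticCurves.kolyvagin N W K →
        ∀ (κ : ZpExtension K 2), κ.IsAnticyclotomic → ∀ (γ : Field.absoluteGaloisGroup K) [Fact (κ.IsTopGenerator γ)]
          (𝔭 : HeightOneSpectrum (𝓞 K)) (h𝔭 : ((2 : ℕ) : 𝓞 K) ∈ 𝔭.asIdeal) (he : 𝔭.asIdeal.ramificationIdx (𝓞 ℚ) = 1)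
          (hf : 𝔭.asIdeal.inertiaDeg (𝓞 ℚ) = 1),
          SchneiderFree.AdditiveControlOnTreeAt 2 κ 𝔭 γ (embAt K 2 𝔭 h𝔭 he hf) P) :
    (ToricPublishedInputs ∧
      LiuZhangZhang2018.thm151_thm153_modularCurve_heegnerVector_additive ∧
      bsdTriple_of_hasCM_of_L_one_ne_zero ∧
      (∀ (K : Type) [Field K] [NumberField K], poitouTate_selmerStructure_duality K) ∧
      (∀ (K : Type) [Field K] [NumberField K], poitouTate_sha_tateDual K) ∧
      (∀ (K : Type) [Field K] [NumberField K] (v : HeightOneSpectrum (𝓞 K)),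
        localEulerPoincareCharacteristic (v.adicCompletion K)) ∧
      fieldCdLE_two_of_numberField ∧
      (∀ (K : Type) [Field K] [NumberField K] (p : ℕ) [Fact p.Prime],
        ZpExtension.decomp_not_le_kerSubgroup_of_isAnticyclotomic K p)) →
    ∀ (W : WeierstrassCurve ℚ) [W.IsElliptic] [W.IsGloballyMinimal],
      W.HasCM → W.analyticRank = 1 → CMSplit W 2 → ¬ Good W 2 →
      (∀ (N : ℕ) [NeZero N] (K : Type) [Field K] [NumberField K] (Dt : ModularParametrizationData W N),
        W.conductorNorm ℤ = N → IsImaginaryQuadratic K → SatisfiesHeegnerHypothesis N K →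
        ∀ (κ : ZpExtension K 2), κ.IsAnticyclotomic → ∀ (γ : Field.absoluteGaloisGroup K) [Fact (κ.IsTopGenerator γ)]
          (𝔭 : HeightOneSpectrum (𝓞 K)), ((2 : ℕ) : 𝓞 K) ∈ 𝔭.asIdeal → 𝔭.asIdeal.ramificationIdx (𝓞 ℚ) = 1 →
          𝔭.asIdeal.inertiaDeg (𝓞 ℚ) = 1 → ∀ (ι' : PadicAlgCl 2 ≃+* ℂ), SchneiderFree.BranchInducesPrime 2 ι' 𝔭 →
          ∃ (ΩK : ℂ) (Ωp : ℂ_[2]) (Qh : PowerSeries (PadicComplexInt 2)),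
            ΩK ≠ 0 ∧ Ωp ≠ 0 ∧ R1.IsBDPLFunctionInt 2 ι' 𝔭 κ γ Dt.f ΩK Ωp (2 * Qh)) →
      (∀ (N : ℕ) [NeZero N] (K : Type) [Field K] [NumberField K],
        W.conductorNorm ℤ = N → IsImaginaryQuadratic K → SatisfiesHeegnerHypothesis N K →
        ∀ (κ : ZpExtension K 2), κ.IsAnticyclotomic → ∀ (γ : Field.absoluteGaloisGroup K) [Fact (κ.IsTopGenerator γ)]
          (𝔭 : HeightOneSpectrum (𝓞 K)), ((2 : ℕ) : 𝓞 K) ∈ 𝔭.asIdeal → 𝔭.asIdeal.ramificationIdx (𝓞 ℚ) = 1 →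
          𝔭.asIdeal.inertiaDeg (𝓞 ℚ) = 1 → ∀ (𝔭' : HeightOneSpectrum (𝓞 K)), ((2 : ℕ) : 𝓞 K) ∈ 𝔭'.asIdeal → 𝔭' ≠ 𝔭 →
          Module.IsTorsion (IwasawaAlgebra 2) (XAc (W.baseChange K) 2 κ 𝔭' ∅ γ)) →
      (∀ (N : ℕ) [NeZero N] (K : Type) [Field K] [NumberField K] (Dt : ModularParametrizationData W N),
        W.conductorNorm ℤ = N → IsImaginaryQuadratic K → SatisfiesHeegnerHypothesis N K →
        ∀ (κ : ZpExtension K 2), κ.IsAnticyclotomic → ∀ (γ : Field.absoluteGaloisGroup K) [Fact (κ.IsTopGenerator γ)]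
          (𝔭 : HeightOneSpectrum (𝓞 K)), ((2 : ℕ) : 𝓞 K) ∈ 𝔭.asIdeal → 𝔭.asIdeal.ramificationIdx (𝓞 ℚ) = 1 →
          𝔭.asIdeal.inertiaDeg (𝓞 ℚ) = 1 → ∀ (𝔭' : HeightOneSpectrum (𝓞 K)), ((2 : ℕ) : 𝓞 K) ∈ 𝔭'.asIdeal → 𝔭' ≠ 𝔭 →
          ∀ (ι' : PadicAlgCl 2 ≃+* ℂ), SchneiderFree.BranchInducesPrime 2 ι' 𝔭 →
          ∀ (ΩK : ℂ) (Ωp : ℂ_[2]) (Qh : PowerSeries (PadicComplexInt 2)), ΩK ≠ 0 → Ωp ≠ 0 →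
            R1.IsBDPLFunctionInt 2 ι' 𝔭 κ γ Dt.f ΩK Ωp (2 * Qh) →
            Module.IsTorsion (IwasawaAlgebra 2) (XAc (W.baseChange K) 2 κ 𝔭' ∅ γ) →
            (XAc.charIdeal (W.baseChange K) 2 κ 𝔭' ∅ γ).map (PowerSeries.map (R1.toCpInt 2)) = Ideal.span {Qh}) →
      (∀ (N : ℕ) [NeZero N] (K : Type) [Field K] [NumberField K]
        (Wd : WeierstrassCurve ℚ) [Wd.IsElliptic] [Wd.IsGloballyMinimal],
        W.conductorNorm ℤ = N → IsImaginaryQuadratic K → SatisfiesHeegnerHypothesis N K →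
        (∃ C : VariableChange ℚ, C • W.quadraticTwist (NumberField.discr K : ℚ) = Wd) →
        (W.quadraticTwist (NumberField.discr K : ℚ)).entireLFunction 1 ≠ 0 → BSDp Wd 2) →
      BSDp W 2 := by
  intro h0 W _ _ hCM hr hsplit hng hFr hTor hEq hTw
  obtain ⟨hF, hL, -, -, -, -, -, -⟩ := h0
  -- `W` is additive at `2` (CM ⟹ not multiplicative), hence `4 ∣ N_W`
  have h4N : 2 ^ 2 ∣ W.conductorNorm ℤ := by
    by_contra h
    rcases hasGoodReductionAtPrime_or_hasMultiplicativeReductionAtPrime_of_not_sq_dvd_conductorNorm (V := W) h with hg | hm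
    · exact hng hg
    · exact Literature.NumberTheory.EllipticCurves.Rank1Residual.not_mult_of_hasCM (W := W) hCM 2 hm
  exact bsdp_two_of_halvedIMCEq_of_controlZero_of_twist hF hL hMilne W h4N hr hFr hTor hEq hTw (hD2a₀ W hCM hr hsplit hng)

end Summit.BirchSwinnertonDyer.BirchSwinnertonDyer.Theorems.PrintCf2.EisensteinTwo

end
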